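import Mathlib.NumberTheory.NumberField.CMField
import Mathlib.LinearAlgebra.Complex.FiniteDimensional
import Mathlib.LinearAlgebra.Complex.Module
import Mathlib.FieldTheory.PrimitiveElement
import Mathlib.RingTheory.TensorProduct.Finite
import Mathlib.LinearAlgebra.Dimension.Constructions
import Mathlib.LinearAlgebra.FiniteDimensional.Lemmas

/-!
# Tier-5 support (seat p3, cell pub-hodge-repro2) — a CM field at a real place of `K⁺`:
the completion is the base change, `ℝ ⊗[K⁺] K ≃ₐ[ℝ] ℂ`

Behind route/T4-B1-p3.md v7 (sub-claim B1, FINAL) l. 33 «At a real place τ of F⁺,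
F ⊗_{F⁺,τ} ℝ ≅ ℂ (n_τ = 2) with c ↦ complex conjugation» and l. 41 «the identification with ℂ
depends on the choice of τ′ ∈ π^{−1}(τ), but the two choices differ by complex conjugation»,
stated for Mathlib's `NumberField.IsCMField K` with `K⁺ = NumberField.maximalRealSubfield K`
(the vocabulary of the Tier-6 composition contract).

A real place of `K⁺` is a ring hom `K⁺ →+* ℝ`; here it is the structure map of an arbitrary
`Algebra K⁺ ℝ`, and `ℂ` carries the `K⁺`-algebra structure through `ℝ` (`IsScalarTower K⁺ ℝ ℂ`
forces `algebraMap K⁺ ℂ = ofReal ∘ algebraMap K⁺ ℝ`, `algebraMap_complex_apply`). A complex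
embedding of `K` extending that real place is then a `K⁺`-algebra hom `φ : K →ₐ[K⁺] ℂ`
(`liftAlgHom` is one, from Mathlib's `ComplexEmbedding.lift`). For every such `φ`:

* `baseChangeHom K φ : ℝ ⊗[K⁺] K →ₐ[ℝ] ℂ`, `r ⊗ x ↦ r • φ x` (Mathlib's `AlgHom.liftEquiv`), is
  BIJECTIVE (`baseChangeEquiv K φ : ℝ ⊗[K⁺] K ≃ₐ[ℝ] ℂ`): surjective because `φ` is not real
  (`K` is totally complex), so `ℝ` and one non-real value `φ x` already generate `ℂ`
  (`subalgebra_eq_top_of_im_ne_zero`); injective by the dimension count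
  `dim_ℝ (ℝ ⊗[K⁺] K) = [K : K⁺] = 2 = dim_ℝ ℂ` (`Module.finrank_baseChange`,
  `Complex.finrank_real_complex`);
* the complex conjugation of `K` (`IsCMField.complexConj K`), base-changed to
  `1 ⊗ complexConj K` (`conjBaseChange K`), corresponds under `baseChangeHom K φ` to `conj` on `ℂ`
  (`baseChangeHom_conjBaseChange`) — B1's «c ↦ complex conjugation»;
* the extensions of the real place to `K` are exactly `φ` and `conj ∘ φ = conjExt φ`
  (`eq_or_eq_conjExt`; there are `[K : K⁺] = 2` of them, `AlgHom.natCard_of_splits`), and the two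
  identifications differ by `conj` (`baseChangeHom_conjExt`, `baseChangeHom_eq_or_conj`) — B1's
  l. 41.

Nothing here is a display; Mathlib only, no cell import. Header declaration (README §8(d)): uses
an L-value-free non-vanishing device: NO.
-/

open scoped TensorProduct ComplexConjugate
open NumberField NumberField.IsCMField Module

namespace Summit.Ventures.HodgeRepro2.T5CMRealBaseChange

variable (K : Type*) [Field K] [NumberField K] [IsCMField K]

/-! ## 1. Two elementary facts: a complex embedding of a CM field is not real, and `ℝ` together
with one non-real number generates `ℂ` -/

/-- A complex embedding of a CM field is never real: some value has non-zero imaginary part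
(Mathlib's `IsTotallyComplex.complexEmbedding_not_isReal`). -/
theorem exists_im_ne_zero (φ : K →+* ℂ) : ∃ x : K, (φ x).im ≠ 0 := by
  by_contra h
  refine IsTotallyComplex.complexEmbedding_not_isReal φ ?_
  rw [ComplexEmbedding.isReal_iff]
  ext x
  rw [ComplexEmbedding.conjugate_coe_eq, Complex.conj_eq_iff_im]
  exact not_not.mp (fun hx => h ⟨x, hx⟩)

/-- A real subalgebra of `ℂ` containing an element with non-zero imaginary part is all of `ℂ`:
it contains `I = (im z)⁻¹ • (z - re z)`, hence every `a + b I`. -/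
theorem subalgebra_eq_top_of_im_ne_zero (S : Subalgebra ℝ ℂ) {z : ℂ} (hz : z ∈ S)
    (him : z.im ≠ 0) : S = ⊤ := by
  have hI : Complex.I ∈ S := by
    have h1 : (z.im)⁻¹ • (z - algebraMap ℝ ℂ z.re) = Complex.I := by
      apply Complex.ext
      · simp
      · simp [him]
    rw [← h1]
    exact S.smul_mem (S.sub_mem hz (S.algebraMap_mem z.re)) _
  refine eq_top_iff.mpr fun w _ => ?_
  rw [← Complex.re_add_im w]
  exact S.add_mem (S.algebraMap_mem w.re) (S.mul_mem (S.algebraMap_mem w.im) hI)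

/-! ## 2. The real place, its two extensions to `K`, and the base change `ℝ ⊗[K⁺] K` -/

section RealPlace

variable [Algebra (maximalRealSubfield K) ℝ] [Algebra (maximalRealSubfield K) ℂ]
  [IsScalarTower (maximalRealSubfield K) ℝ ℂ]

omit [NumberField K] [IsCMField K] in
/-- The structure map of `ℂ` over `K⁺` is the real place followed by `ℝ ⊆ ℂ`. -/
theorem algebraMap_complex_apply (x : maximalRealSubfield K) :
    algebraMap (maximalRealSubfield K) ℂ x =
      ((algebraMap (maximalRealSubfield K) ℝ x : ℝ) : ℂ) :=
  IsScalarTower.algebraMap_apply (maximalRealSubfield K) ℝ ℂ x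

/-- A complex embedding of `K` extending the real place, as a `K⁺`-algebra hom (Mathlib's
`ComplexEmbedding.lift`). -/
noncomputable def liftAlgHom : K →ₐ[maximalRealSubfield K] ℂ :=
  AlgHom.mk (ComplexEmbedding.lift K (algebraMap (maximalRealSubfield K) ℂ))
    (fun x => ComplexEmbedding.lift_algebraMap_apply K _ x)

omit [IsCMField K] in
/-- `liftAlgHom` restricts to the real place on `K⁺`. -/
theorem liftAlgHom_algebraMap (x : maximalRealSubfield K) :
    liftAlgHom K (algebraMap (maximalRealSubfield K) K x) =
      ((algebraMap (maximalRealSubfield K) ℝ x : ℝ) : ℂ) := by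
  rw [AlgHom.commutes, algebraMap_complex_apply]

variable {K}

/-- The conjugate extension `conj ∘ φ`, again a `K⁺`-algebra hom (the real place takes real
values, which `conj` fixes). -/
noncomputable def conjExt (φ : K →ₐ[maximalRealSubfield K] ℂ) :
    K →ₐ[maximalRealSubfield K] ℂ :=
  AlgHom.mk (ComplexEmbedding.conjugate (φ : K →+* ℂ)) (fun x => by
    show ComplexEmbedding.conjugate (φ : K →+* ℂ) (algebraMap (maximalRealSubfield K) K x) =
      algebraMap (maximalRealSubfield K) ℂ x
    rw [ComplexEmbedding.conjugate_coe_eq, AlgHom.coe_toRingHom, AlgHom.commutes,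
      algebraMap_complex_apply, Complex.conj_ofReal])

omit [NumberField K] [IsCMField K] in
/-- `conjExt φ x = conj (φ x)`. -/
@[simp] theorem conjExt_apply (φ : K →ₐ[maximalRealSubfield K] ℂ) (x : K) :
    conjExt φ x = conj (φ x) := rfl

/-- `conj ∘ φ ≠ φ`: `K` is totally complex. -/
theorem conjExt_ne (φ : K →ₐ[maximalRealSubfield K] ℂ) : conjExt φ ≠ φ := by
  intro h
  obtain ⟨x, hx⟩ := exists_im_ne_zero K (φ : K →+* ℂ)
  have h' : conjExt φ x = φ x := by rw [h]
  rw [conjExt_apply, Complex.conj_eq_iff_im] at h'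
  exact hx h'

/-- The extensions of the real place to `K` are exactly `φ` and `conj ∘ φ`: there are
`[K : K⁺] = 2` of them (`AlgHom.natCard_of_splits`) and `conj ∘ φ ≠ φ`. -/
theorem eq_or_eq_conjExt (φ φ' : K →ₐ[maximalRealSubfield K] ℂ) :
    φ' = φ ∨ φ' = conjExt φ := by
  have hcard : Nat.card (K →ₐ[maximalRealSubfield K] ℂ) = 2 := by
    rw [AlgHom.natCard_of_splits (maximalRealSubfield K) K ℂ (fun _ => IsAlgClosed.splits _),
      Algebra.IsQuadraticExtension.finrank_eq_two (maximalRealSubfield K) K]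
  obtain ⟨ψ, -, hψ⟩ := (Nat.card_eq_two_iff' φ).mp hcard
  by_cases h : φ' = φ
  · exact Or.inl h
  · exact Or.inr ((hψ φ' h).trans (hψ (conjExt φ) (conjExt_ne φ)).symm)

variable (K)

/-- The base-change map `ℝ ⊗[K⁺] K →ₐ[ℝ] ℂ`, `r ⊗ x ↦ r • φ x` (Mathlib's `AlgHom.liftEquiv`). -/
noncomputable def baseChangeHom (φ : K →ₐ[maximalRealSubfield K] ℂ) :
    ℝ ⊗[maximalRealSubfield K] K →ₐ[ℝ] ℂ :=
  AlgHom.liftEquiv (maximalRealSubfield K) ℝ K ℂ φ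

omit [NumberField K] [IsCMField K] in
/-- `baseChangeHom K φ (r ⊗ x) = r • φ x`. -/
@[simp] theorem baseChangeHom_tmul (φ : K →ₐ[maximalRealSubfield K] ℂ) (r : ℝ) (x : K) :
    baseChangeHom K φ (r ⊗ₜ x) = r • φ x :=
  AlgHom.liftEquiv_tmul φ r x

omit [NumberField K] [IsCMField K] in
/-- `baseChangeHom K φ (1 ⊗ x) = φ x`. -/
theorem baseChangeHom_one_tmul (φ : K →ₐ[maximalRealSubfield K] ℂ) (x : K) :
    baseChangeHom K φ (1 ⊗ₜ x) = φ x := by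
  rw [baseChangeHom_tmul, one_smul]

omit [NumberField K] [IsCMField K] in
/-- On `K⁺ ⊂ K`, the base change is the real place: `1 ⊗ x ↦ (algebraMap K⁺ ℝ x : ℂ)`. -/
theorem baseChangeHom_one_tmul_algebraMap (φ : K →ₐ[maximalRealSubfield K] ℂ)
    (x : maximalRealSubfield K) :
    baseChangeHom K φ (1 ⊗ₜ algebraMap (maximalRealSubfield K) K x) =
      ((algebraMap (maximalRealSubfield K) ℝ x : ℝ) : ℂ) := by
  rw [baseChangeHom_one_tmul, AlgHom.commutes, algebraMap_complex_apply]

/-- Surjectivity: `ℝ` and one non-real value `φ x` generate `ℂ`. -/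
theorem baseChangeHom_surjective (φ : K →ₐ[maximalRealSubfield K] ℂ) :
    Function.Surjective (baseChangeHom K φ) := by
  obtain ⟨x, hx⟩ := exists_im_ne_zero K (φ : K →+* ℂ)
  have hmem : φ x ∈ (baseChangeHom K φ).range := ⟨1 ⊗ₜ x, baseChangeHom_one_tmul K φ x⟩
  have htop : (baseChangeHom K φ).range = ⊤ := subalgebra_eq_top_of_im_ne_zero _ hmem hx
  intro w
  exact (AlgHom.mem_range _).mp (by rw [htop]; exact Algebra.mem_top)

omit [Algebra (maximalRealSubfield K) ℂ] [IsScalarTower (maximalRealSubfield K) ℝ ℂ] in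
/-- `dim_ℝ (ℝ ⊗[K⁺] K) = [K : K⁺] = 2`. -/
theorem finrank_baseChange_eq_two : finrank ℝ (ℝ ⊗[maximalRealSubfield K] K) = 2 := by
  rw [Module.finrank_baseChange, Algebra.IsQuadraticExtension.finrank_eq_two (maximalRealSubfield K) K]

/-- Bijectivity, by the dimension count `2 = 2`. -/
theorem baseChangeHom_bijective (φ : K →ₐ[maximalRealSubfield K] ℂ) :
    Function.Bijective (baseChangeHom K φ) := by
  refine ⟨?_, baseChangeHom_surjective K φ⟩
  have h : finrank ℝ (ℝ ⊗[maximalRealSubfield K] K) = finrank ℝ ℂ := by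
    rw [finrank_baseChange_eq_two, Complex.finrank_real_complex]
  exact (LinearMap.injective_iff_surjective_of_finrank_eq_finrank h
    (f := (baseChangeHom K φ).toLinearMap)).mpr (baseChangeHom_surjective K φ)

/-- THE IDENTIFICATION of B1 l. 33: `ℝ ⊗[K⁺] K ≃ₐ[ℝ] ℂ` along the extension `φ` of the real
place. -/
noncomputable def baseChangeEquiv (φ : K →ₐ[maximalRealSubfield K] ℂ) :
    ℝ ⊗[maximalRealSubfield K] K ≃ₐ[ℝ] ℂ :=
  AlgEquiv.ofBijective (baseChangeHom K φ) (baseChangeHom_bijective K φ)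

/-- `baseChangeEquiv K φ` is `baseChangeHom K φ` as a function. -/
@[simp] theorem baseChangeEquiv_apply (φ : K →ₐ[maximalRealSubfield K] ℂ)
    (y : ℝ ⊗[maximalRealSubfield K] K) : baseChangeEquiv K φ y = baseChangeHom K φ y := rfl

/-- `baseChangeEquiv K φ (r ⊗ x) = r • φ x`. -/
theorem baseChangeEquiv_tmul (φ : K →ₐ[maximalRealSubfield K] ℂ) (r : ℝ) (x : K) :
    baseChangeEquiv K φ (r ⊗ₜ x) = r • φ x :=
  baseChangeHom_tmul K φ r x

/-! ## 3. Complex conjugation: `1 ⊗ complexConj K` IS `conj`, and the other extension gives the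
conjugate identification -/

/-- The complex conjugation of `K`, base-changed to `ℝ ⊗[K⁺] K` as `1 ⊗ complexConj K`. -/
noncomputable def conjBaseChange :
    ℝ ⊗[maximalRealSubfield K] K →ₐ[ℝ] ℝ ⊗[maximalRealSubfield K] K :=
  Algebra.TensorProduct.map (AlgHom.id ℝ ℝ) (complexConj K).toAlgHom

omit [Algebra (maximalRealSubfield K) ℂ] [IsScalarTower (maximalRealSubfield K) ℝ ℂ] in
/-- `conjBaseChange K (r ⊗ x) = r ⊗ complexConj K x`. -/
@[simp] theorem conjBaseChange_tmul (r : ℝ) (x : K) :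
    conjBaseChange K (r ⊗ₜ x) = r ⊗ₜ complexConj K x := by
  simp [conjBaseChange, Algebra.TensorProduct.map_tmul]

/-- B1 l. 33, «c ↦ complex conjugation»: under `baseChangeHom K φ`, the base-changed conjugation
`1 ⊗ complexConj K` is the complex conjugation of `ℂ` (Mathlib's
`IsCMField.complexEmbedding_complexConj`). -/
theorem baseChangeHom_conjBaseChange (φ : K →ₐ[maximalRealSubfield K] ℂ)
    (y : ℝ ⊗[maximalRealSubfield K] K) :
    baseChangeHom K φ (conjBaseChange K y) = conj (baseChangeHom K φ y) := by
  induction y using TensorProduct.induction_on with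
  | zero => simp
  | tmul r x =>
    rw [conjBaseChange_tmul, baseChangeHom_tmul, baseChangeHom_tmul, Complex.real_smul,
      Complex.real_smul, map_mul, Complex.conj_ofReal]
    congr 1
    exact complexEmbedding_complexConj K (φ : K →+* ℂ) x
  | add y z hy hz => simp only [map_add, hy, hz]

/-- The same for the isomorphism `baseChangeEquiv K φ`. -/
theorem baseChangeEquiv_conjBaseChange (φ : K →ₐ[maximalRealSubfield K] ℂ)
    (y : ℝ ⊗[maximalRealSubfield K] K) :
    baseChangeEquiv K φ (conjBaseChange K y) = conj (baseChangeEquiv K φ y) :=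
  baseChangeHom_conjBaseChange K φ y

omit [NumberField K] [IsCMField K] in
/-- B1 l. 41: the other extension `conj ∘ φ` gives the conjugate identification. -/
theorem baseChangeHom_conjExt (φ : K →ₐ[maximalRealSubfield K] ℂ)
    (y : ℝ ⊗[maximalRealSubfield K] K) :
    baseChangeHom K (conjExt φ) y = conj (baseChangeHom K φ y) := by
  induction y using TensorProduct.induction_on with
  | zero => simp
  | tmul r x =>
    rw [baseChangeHom_tmul, baseChangeHom_tmul, conjExt_apply, Complex.real_smul,
      Complex.real_smul, map_mul, Complex.conj_ofReal]
  | add y z hy hz => simp only [map_add, hy, hz]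

/-- B1 l. 41, in full: any two extensions give the same identification or conjugate ones. -/
theorem baseChangeHom_eq_or_conj (φ φ' : K →ₐ[maximalRealSubfield K] ℂ)
    (y : ℝ ⊗[maximalRealSubfield K] K) :
    baseChangeHom K φ' y = baseChangeHom K φ y ∨
      baseChangeHom K φ' y = conj (baseChangeHom K φ y) := by
  rcases eq_or_eq_conjExt φ φ' with h | h
  · exact Or.inl (by rw [h])
  · exact Or.inr (by rw [h, baseChangeHom_conjExt])

end RealPlace

end Summit.Ventures.HodgeRepro2.T5CMRealBaseChange
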